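import Mathlib
import Summits.NavierStokesRegularity.NavierStokesRegularity.Theorems.LocalSineTubeDoorLocalPointZoomSlices
import HarnessLib

/-!
# Crux `AveragedConeLiouville` (stmt-NavierStokesRegularity-26889, route AxisTwistDoor), line `lrt_shell` v2, stub (0)
# `stub_zoomToSlackFree` — part 2a: VORTICITY CONVERGENCE OF THE PROFILE ZOOMS ON EVERY SLICE, AND THE SIGN OF THE LIMIT

`--supports stmt-NavierStokesRegularity-26889` (helper).  Author: prover seat `ns-el-k1b` (g0), width seat 3 under LEAD ns-atd-p1.

* `curl_tendsto_of_frame_cont` — the component form of `LocalSineTubeDoorLocalPointZoomSlices.localPointZoomSlices`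
  (= `ExtremiserLiouville`-free twin of `FilamentPinchDoorSuitableHalfSpaceZoom.curl_tendsto_of_frame`) with the classical-solution
  hypothesis replaced by mere CONTINUITY of `u` on `[0,T) × ℝ³` (all that `localZoomFrame_curl_tendsto` uses): vorticity
  convergence of the zooms on every slice `s < 0`.
* `profileZoom_curl_tendsto` — for an energy-class PROFILE `v` zoomed into itself (frame of
  `AveragedConeLiouvilleProfileZoom.profileZoomFrame`): with `u(t) := v(t − 1)`, `T = 1`, `ν = 1`, `R = 2`, `x₀ = 0` the
  identification `λⱼ v(λⱼ² s, λⱼ y) = (Rλⱼ/2) u(T + (Rλⱼ/2)² s, (Rλⱼ/2) y)` is definitional, the local Type-I bound of `u` is the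
  rate of `v`; hence `λⱼ² curl v(λⱼ² s)(λⱼ y) → curl v₁(s)(y)` for every `s < 0`, `y`.
* `inner_curl_nonneg_of_profileZoom` — the SIGN `⟪curl v(s) y, e⟫ ≥ 0` passes to the zoom limit `v₁` (each zoomed vorticity is a
  positive multiple of a vorticity value of `v`; `ge_of_tendsto`).
WHAT THIS IS NOT: not the stub (the slack-free GLOBAL cone of the limit — part 2b — needs uniform interior gradient bounds of the
zooms on circles); nothing about NS regularity.
-/

noncomputable section

set_option linter.dupNamespace false

namespace Summit.NavierStokesRegularity.NavierStokesRegularity.Theorems.AveragedConeLiouvilleProfileZoom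

open MeasureTheory Set Function Filter Topology TopologicalSpace Metric
open Literature.Analysis Literature.Analysis.FluidPDE Literature.Analysis.FluidPDE.SereginSverak2009
open Summit.NavierStokesRegularity.NavierStokesRegularity.Theorems
open Summit.NavierStokesRegularity.NavierStokesRegularity.Theorems.LocalSineTubeDoorLocalPointZoomFrame
open Summit.NavierStokesRegularity.NavierStokesRegularity.Theorems.LocalSineTubeDoorLocalPointZoomCurl
open Summit.NavierStokesRegularity.NavierStokesRegularity.Theorems.LocalSineTubeDoorLocalPointZoomSlices
open Summit.NavierStokesRegularity.NavierStokesRegularity.Theorems.LocalSineTubeDoorLocalPointZoomZoom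
open scoped NNReal ENNReal RealInnerProductSpace InnerProductSpace

/-- **Vorticity-slice convergence from the components of a zoom frame, continuity-only form** (the body of
`LocalSineTubeDoorLocalPointZoomSlices.localPointZoomSlices`; the classical-solution hypothesis of
`FilamentPinchDoorSuitableHalfSpaceZoom.curl_tendsto_of_frame` is weakened to continuity of `u` on `[0,T) × ℝ³`, which is all
`localZoomFrame_curl_tendsto` uses). [cite: AlbrittonBarker2019, §2; KochNadirashviliSereginSverak2009, §5–6] -/
theorem curl_tendsto_of_frame_cont {ν T : ℝ} (hν : 0 < ν) (hT : 0 < T)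
    {u : ℝ → (EuclideanSpace ℝ (Fin 3)) → (EuclideanSpace ℝ (Fin 3))}
    (hucont : ContinuousOn (uncurry u) (Ico 0 T ×ˢ univ))
    {x₀ : (EuclideanSpace ℝ (Fin 3))} {ρ M : ℝ} (hρ : 0 < ρ)
    (hM : ∀ t ∈ Ico 0 T, T - ρ ^ 2 < t → ∀ x ∈ ball x₀ ρ, ‖u t x‖ * Real.sqrt (ν * (T - t)) ≤ M)
    {R : ℝ} (hR : 0 < R) {v' : ℝ → (EuclideanSpace ℝ (Fin 3)) → (EuclideanSpace ℝ (Fin 3))} {π' : ℝ → (EuclideanSpace ℝ (Fin 3)) → ℝ}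
    (hball1 : IsSuitableWeakSolutionInBall 1 0 v' π') {lam : ℕ → ℝ} (hlam : ∀ j, 0 < lam j)
    (hlam0 : Tendsto lam atTop (𝓝 0)) {Ks : ℝ≥0} {r₁ : ℝ} (hr₁ : 0 < r₁) (hr₁1 : r₁ ≤ 1)
    (hKs : ∀ r ∈ Ioc (0 : ℝ) r₁, cknD r (0 : ℝ × (EuclideanSpace ℝ (Fin 3))) π' ≤ Ks)
    (hpt : ∀ (j : ℕ) (s : ℝ) (y : (EuclideanSpace ℝ (Fin 3))), ((lam j) • stPull ((lam j) ^ 2) (lam j) (0 : ℝ) (0 : (EuclideanSpace ℝ (Fin 3))) v') s y =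
      ((R * (lam j / 2)) / ν) • u (T + (R * (lam j / 2)) ^ 2 * s / ν) (x₀ + (R * (lam j / 2)) • y))
    {w v₁ : ℝ → (EuclideanSpace ℝ (Fin 3)) → (EuclideanSpace ℝ (Fin 3))}
    (hL3 : ∀ a : ℝ, 0 < a → Tendsto (fun j => eLpNorm (uncurry ((lam j) • stPull ((lam j) ^ 2) (lam j) (0 : ℝ) (0 : (EuclideanSpace ℝ (Fin 3))) v') - uncurry w) 3
      (volume.restrict (parabolicCylinder a (0 : ℝ × (EuclideanSpace ℝ (Fin 3)))))) atTop (𝓝 0))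
    (hae : ∀ᵐ x ∂(volume.restrict (Iio (0 : ℝ) ×ˢ (univ : Set (EuclideanSpace ℝ (Fin 3))))), uncurry w x = uncurry v₁ x)
    {C₁ : ℝ} (hP : HasTypeITimeDecay C₁ v₁ ∧ ContinuousOn (uncurry v₁) (Iio (0 : ℝ) ×ˢ univ) ∧
      (∀ s t : ℝ, s < t → t < 0 → ∀ x,
        v₁ t x = UnboundedOperators.heatExtension (v₁ s) (t - s) x - oseenDuhamel 1 s v₁ v₁ t x) ∧
      (∀ t < 0, VectorCalculus.IsDivFree (v₁ t)))
    (s : ℝ) (hs : s < 0) (y : (EuclideanSpace ℝ (Fin 3))) :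
    Tendsto (fun j => ((R * (lam j / 2)) ^ 2 / ν) •
        curl (u (T + (R * (lam j / 2)) ^ 2 * s / ν)) (x₀ + (R * (lam j / 2)) • y)) atTop
      (𝓝 (curl (v₁ s) y)) := by
  -- ## the scaling factor `σ = √(−s)`
  have hns : 0 < -s := neg_pos.2 hs
  set σ : ℝ := Real.sqrt (-s) with hσdef
  have hσ : 0 < σ := Real.sqrt_pos.2 hns
  have hσ2 : σ ^ 2 = -s := Real.sq_sqrt hns.le
  have hσne : σ ≠ 0 := hσ.ne'
  -- ## the rescaled frame
  set lam' : ℕ → ℝ := fun j => σ * lam j with hlam'def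
  have hlam' : ∀ j, 0 < lam' j := fun j => mul_pos hσ (hlam j)
  have hlam0' : Tendsto lam' atTop (𝓝 0) := by
    show Tendsto (fun j => σ * lam j) atTop (𝓝 0)
    simpa using hlam0.const_mul σ
  set w' : ℝ → (EuclideanSpace ℝ (Fin 3)) → (EuclideanSpace ℝ (Fin 3)) := σ • stPull (σ ^ 2) σ (0 : ℝ) (0 : (EuclideanSpace ℝ (Fin 3))) w with hw'def
  set v₁' : ℝ → (EuclideanSpace ℝ (Fin 3)) → (EuclideanSpace ℝ (Fin 3)) := σ • stPull (σ ^ 2) σ (0 : ℝ) (0 : (EuclideanSpace ℝ (Fin 3))) v₁ with hv₁'def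
  have hZZ : ∀ j, (lam' j) • stPull ((lam' j) ^ 2) (lam' j) (0 : ℝ) (0 : (EuclideanSpace ℝ (Fin 3))) v' =
      σ • stPull (σ ^ 2) σ (0 : ℝ) (0 : (EuclideanSpace ℝ (Fin 3)))
        ((lam j) • stPull ((lam j) ^ 2) (lam j) (0 : ℝ) (0 : (EuclideanSpace ℝ (Fin 3))) v') := by
    intro j
    simp only [hlam'def]
    rw [zoom_zoom]
  -- (pt') identification with the zooms of `u` at the scales `R σλⱼ/2`
  have hpt' : ∀ (j : ℕ) (s' : ℝ) (y' : (EuclideanSpace ℝ (Fin 3))),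
      ((lam' j) • stPull ((lam' j) ^ 2) (lam' j) (0 : ℝ) (0 : (EuclideanSpace ℝ (Fin 3))) v') s' y' =
        ((R * (lam' j / 2)) / ν) • u (T + (R * (lam' j / 2)) ^ 2 * s' / ν) (x₀ + (R * (lam' j / 2)) • y') := by
    intro j s' y'
    have h := hpt j (σ ^ 2 * s') (σ • y')
    simp only [smul_stPull_apply, zero_add] at h ⊢
    simp only [hlam'def]
    rw [show (σ * lam j) ^ 2 * s' = lam j ^ 2 * (σ ^ 2 * s') by ring,
      show (σ * lam j) • y' = lam j • σ • y' by rw [smul_smul, mul_comm],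
      mul_smul, h, smul_smul, smul_smul,
      show σ * (R * (lam j / 2) / ν) = R * (σ * lam j / 2) / ν by ring,
      show T + (R * (lam j / 2)) ^ 2 * (σ ^ 2 * s') / ν = T + (R * (σ * lam j / 2)) ^ 2 * s' / ν by ring,
      show R * (lam j / 2) * σ = R * (σ * lam j / 2) by ring]
  -- (L3') local `L³` convergence of the rescaled zooms to `w'`
  have hus : ∀ f g : ℝ → (EuclideanSpace ℝ (Fin 3)) → (EuclideanSpace ℝ (Fin 3)), uncurry (f - g) = uncurry f - uncurry g := fun f g => rfl
  have hL3' : ∀ a : ℝ, 0 < a → Tendsto (fun j => eLpNorm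
      (uncurry ((lam' j) • stPull ((lam' j) ^ 2) (lam' j) (0 : ℝ) (0 : (EuclideanSpace ℝ (Fin 3))) v') - uncurry w') 3
      (volume.restrict (parabolicCylinder a (0 : ℝ × (EuclideanSpace ℝ (Fin 3)))))) atTop (𝓝 0) := by
    intro a ha
    have hdiff : ∀ j, uncurry ((lam' j) • stPull ((lam' j) ^ 2) (lam' j) (0 : ℝ) (0 : (EuclideanSpace ℝ (Fin 3))) v') -
        uncurry w' = uncurry (σ • stPull (σ ^ 2) σ (0 : ℝ) (0 : (EuclideanSpace ℝ (Fin 3)))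
          ((lam j) • stPull ((lam j) ^ 2) (lam j) (0 : ℝ) (0 : (EuclideanSpace ℝ (Fin 3))) v' - w)) := by
      intro j
      rw [hZZ j]
      funext z
      obtain ⟨s', y'⟩ := z
      simp only [hw'def, uncurry_apply_pair, Pi.sub_apply, smul_stPull_apply, smul_sub]
    have hconst : (‖σ‖ₑ * (ENNReal.ofReal ((σ ^ 2 * σ ^ 3)⁻¹)) ^ (1 / (3 : ℝ≥0∞).toReal)) ≠ ⊤ :=
      ENNReal.mul_ne_top enorm_ne_top
        (ENNReal.rpow_ne_top_of_nonneg (one_div_nonneg.2 ENNReal.toReal_nonneg) ENNReal.ofReal_ne_top)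
    have key := ENNReal.Tendsto.const_mul (hL3 (a * σ) (mul_pos ha hσ)) (Or.inr hconst)
    rw [mul_zero] at key
    refine key.congr fun j => ?_
    rw [hdiff j]
    conv_rhs => rw [show a = a * σ / σ by field_simp]
    rw [eLpNorm_uncurry_zoom hσ σ _ (a * σ) three_ne_zero ENNReal.ofNat_ne_top, hus]
  -- (ae') the rescaled limit agrees a.e. with the rescaled profile
  have hslab : stAffine (σ ^ 2) σ (0 : ℝ) (0 : (EuclideanSpace ℝ (Fin 3))) ⁻¹' (Iio (0 : ℝ) ×ˢ (univ : Set (EuclideanSpace ℝ (Fin 3)))) =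
      Iio (0 : ℝ) ×ˢ (univ : Set (EuclideanSpace ℝ (Fin 3))) := by
    ext z
    simp only [mem_preimage, mem_prod, mem_Iio, mem_univ, and_true, stAffine_fst, zero_add]
    exact ⟨fun h => neg_of_mul_neg_right h (pow_pos hσ 2).le,
      fun h => mul_neg_of_pos_of_neg (pow_pos hσ 2) h⟩
  have hae' : ∀ᵐ x ∂(volume.restrict (Iio (0 : ℝ) ×ˢ (univ : Set (EuclideanSpace ℝ (Fin 3))))),
      uncurry w' x = uncurry v₁' x := by
    have h := ae_eq_restrict_comp_stAffine (f := uncurry w) (g := uncurry v₁) (pow_pos hσ 2) hσ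
      (0 : ℝ) (0 : (EuclideanSpace ℝ (Fin 3))) hae
    rw [hslab] at h
    filter_upwards [h] with z hz
    show σ • uncurry w (stAffine (σ ^ 2) σ (0 : ℝ) (0 : (EuclideanSpace ℝ (Fin 3))) z) =
      σ • uncurry v₁ (stAffine (σ ^ 2) σ (0 : ℝ) (0 : (EuclideanSpace ℝ (Fin 3))) z)
    rw [show uncurry w (stAffine (σ ^ 2) σ (0 : ℝ) (0 : (EuclideanSpace ℝ (Fin 3))) z) =
      uncurry v₁ (stAffine (σ ^ 2) σ (0 : ℝ) (0 : (EuclideanSpace ℝ (Fin 3))) z) from hz]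
  -- (P') the rescaled profile is in the class (scaling invariance of rate / continuity / mildness)
  have hrate' : HasTypeITimeDecay C₁ v₁' := rate_smul_stPull hP.1 hσ
  have hcont' : ContinuousOn (uncurry v₁') (Iio (0 : ℝ) ×ˢ univ) := cont_smul_stPull hP.2.1 hσ
  have hmild' := mild_smul_stPull hP.2.2.1 hσ
  -- ## the interior upgrade at time `−1` of the rescaled frame
  have key := localZoomFrame_curl_tendsto hν hT hucont hρ hM hR hball1 hlam'
    hlam0' hr₁ hr₁1 hKs hpt' hL3' hae' hrate' hcont' hmild' (σ⁻¹ • y)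
  -- ## identification of the terms
  have hcurlZ : ∀ j, curl (((lam' j) • stPull ((lam' j) ^ 2) (lam' j) (0 : ℝ) (0 : (EuclideanSpace ℝ (Fin 3))) v') (-1))
      (σ⁻¹ • y) = (-s) • (((R * (lam j / 2)) ^ 2 / ν) •
        curl (u (T + (R * (lam j / 2)) ^ 2 * s / ν)) (x₀ + (R * (lam j / 2)) • y)) := by
    intro j
    have hfun : ((lam' j) • stPull ((lam' j) ^ 2) (lam' j) (0 : ℝ) (0 : (EuclideanSpace ℝ (Fin 3))) v') (-1) =
        (((R * (lam' j / 2)) / ν) • stPull ((R * (lam' j / 2)) ^ 2 / ν) (R * (lam' j / 2)) T x₀ u)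
          (-1) := by
      funext y'
      rw [hpt' j (-1) y', smul_stPull_apply]
      congr 2
      ring
    have e1 : R * (σ * lam j / 2) / ν * (R * (σ * lam j / 2)) = (-s) * ((R * (lam j / 2)) ^ 2 / ν) := by
      rw [← hσ2]; ring
    have e2 : T + (R * (σ * lam j / 2)) ^ 2 / ν * (-1) = T + (R * (lam j / 2)) ^ 2 * s / ν := by
      have hs' : s = -σ ^ 2 := by rw [hσ2]; ring
      rw [hs']; ring
    have e3 : R * (σ * lam j / 2) * σ⁻¹ = R * (lam j / 2) := by
      calc R * (σ * lam j / 2) * σ⁻¹ = R * (lam j / 2) * (σ * σ⁻¹) := by ring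
        _ = R * (lam j / 2) := by rw [mul_inv_cancel₀ hσne, mul_one]
    rw [hfun, curl_smul_stPull]
    simp only [hlam'def, smul_smul]
    rw [e1, e2, e3]
  have hlimit : curl (v₁' (-1)) (σ⁻¹ • y) = (-s) • curl (v₁ s) y := by
    simp only [hv₁'def]
    rw [curl_smul_stPull]
    simp only [smul_smul, mul_inv_cancel₀ hσne, one_smul, zero_add]
    rw [show σ ^ 2 * (-1) = s by rw [hσ2]; ring, show σ * σ = -s by rw [← hσ2]; ring]
  -- ## conclusion: divide by `−s`
  have key' : Tendsto (fun j => (-s) • (((R * (lam j / 2)) ^ 2 / ν) •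
      curl (u (T + (R * (lam j / 2)) ^ 2 * s / ν)) (x₀ + (R * (lam j / 2)) • y))) atTop
      (𝓝 ((-s) • curl (v₁ s) y)) := by
    rw [← hlimit]
    exact Tendsto.congr hcurlZ key
  have key3 := key'.const_smul (-s)⁻¹
  simp only [smul_smul, inv_mul_cancel₀ hns.ne', inv_mul_cancel_left₀ hns.ne', one_smul]
    at key3
  exact key3



/-- **Vorticity convergence of the zooms of an energy-class profile on every slice.**  For a profile `v` with Type-I rate `C`,
continuous on the open slab, and the frame data of `profileZoomFrame` (`hball1`, `λⱼ`, `hKs`, the `L³_loc` limit `w = v₁` a.e. with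
`v₁` in the profile class): `λⱼ² · curl v(λⱼ² s)(λⱼ y) → curl v₁(s)(y)` for every `s < 0`, `y`. [cite: AlbrittonBarker2019, §2; KochNadirashviliSereginSverak2009, §5–6] -/
theorem profileZoom_curl_tendsto {C : ℝ} {v : ℝ → EuclideanSpace ℝ (Fin 3) → EuclideanSpace ℝ (Fin 3)}
    (hrate : HasTypeITimeDecay C v) (hcont : ContinuousOn (uncurry v) (Iio (0 : ℝ) ×ˢ univ))
    {πn : ℝ → EuclideanSpace ℝ (Fin 3) → ℝ} (hball1 : IsSuitableWeakSolutionInBall 1 0 v πn)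
    {lam : ℕ → ℝ} (hlam : ∀ j, 0 < lam j) (hlam0 : Tendsto lam atTop (𝓝 0))
    {Ks : ℝ≥0} {r₁ : ℝ} (hr₁ : 0 < r₁) (hr₁1 : r₁ ≤ 1) (hKs : ∀ r ∈ Ioc (0 : ℝ) r₁, cknD r (0 : ℝ × EuclideanSpace ℝ (Fin 3)) πn ≤ Ks)
    {w v₁ : ℝ → EuclideanSpace ℝ (Fin 3) → EuclideanSpace ℝ (Fin 3)}
    (hL3 : ∀ a : ℝ, 0 < a → Tendsto (fun j => eLpNorm (uncurry ((lam j) • stPull ((lam j) ^ 2) (lam j) (0 : ℝ) (0 : EuclideanSpace ℝ (Fin 3)) v) - uncurry w) 3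
      (volume.restrict (parabolicCylinder a (0 : ℝ × EuclideanSpace ℝ (Fin 3))))) atTop (𝓝 0))
    (hae : ∀ᵐ x ∂(volume.restrict (Iio (0 : ℝ) ×ˢ (univ : Set (EuclideanSpace ℝ (Fin 3))))), uncurry w x = uncurry v₁ x)
    {C₁ : ℝ} (hP : HasTypeITimeDecay C₁ v₁ ∧ ContinuousOn (uncurry v₁) (Iio (0 : ℝ) ×ˢ univ) ∧
      (∀ s t : ℝ, s < t → t < 0 → ∀ x,
        v₁ t x = UnboundedOperators.heatExtension (v₁ s) (t - s) x - oseenDuhamel 1 s v₁ v₁ t x) ∧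
      (∀ t < 0, VectorCalculus.IsDivFree (v₁ t)))
    (s : ℝ) (hs : s < 0) (y : EuclideanSpace ℝ (Fin 3)) :
    Tendsto (fun j => (lam j) ^ 2 • curl (v ((lam j) ^ 2 * s)) ((lam j) • y)) atTop (𝓝 (curl (v₁ s) y)) := by
  -- the time-shifted profile as the "pre-blow-up solution": `u(t) = v(t − 1)` on `[0,1)`, `T = 1`, `ν = 1`, `R = 2`, `x₀ = 0`
  set u : ℝ → EuclideanSpace ℝ (Fin 3) → EuclideanSpace ℝ (Fin 3) := fun t x => v (t - 1) x with hudef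
  have hucont : ContinuousOn (uncurry u) (Ico (0 : ℝ) 1 ×ˢ univ) := by
    have hφ : Continuous fun z : ℝ × EuclideanSpace ℝ (Fin 3) => (z.1 - 1, z.2) := (continuous_fst.sub continuous_const).prodMk continuous_snd
    have hmaps : MapsTo (fun z : ℝ × EuclideanSpace ℝ (Fin 3) => (z.1 - 1, z.2)) (Ico (0 : ℝ) 1 ×ˢ univ) (Iio (0 : ℝ) ×ˢ univ) := by
      intro z hz
      obtain ⟨h1, -⟩ := mem_prod.1 hz
      exact mem_prod.2 ⟨by simp only [mem_Iio]; linarith [h1.2], mem_univ _⟩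
    have heq : uncurry u = uncurry v ∘ fun z : ℝ × EuclideanSpace ℝ (Fin 3) => (z.1 - 1, z.2) := by
      funext z; rfl
    rw [heq]
    exact hcont.comp hφ.continuousOn hmaps
  have hM : ∀ t ∈ Ico (0 : ℝ) 1, 1 - (1 : ℝ) ^ 2 < t → ∀ x ∈ ball (0 : EuclideanSpace ℝ (Fin 3)) 1, ‖u t x‖ * Real.sqrt (1 * (1 - t)) ≤ C := by
    intro t ht _ x _
    have hneg : t - 1 < 0 := by linarith [ht.2]
    have h := hrate (t - 1) hneg x
    have hsq : 0 < Real.sqrt (-(t - 1)) := Real.sqrt_pos.2 (by linarith)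
    rw [one_mul, show (1 : ℝ) - t = -(t - 1) by ring]
    calc ‖u t x‖ * Real.sqrt (-(t - 1)) = ‖v (t - 1) x‖ * Real.sqrt (-(t - 1)) := rfl
      _ ≤ C / Real.sqrt (-(t - 1)) * Real.sqrt (-(t - 1)) := mul_le_mul_of_nonneg_right h hsq.le
      _ = C := div_mul_cancel₀ C hsq.ne'
  have hpt : ∀ (j : ℕ) (s : ℝ) (y : EuclideanSpace ℝ (Fin 3)), ((lam j) • stPull ((lam j) ^ 2) (lam j) (0 : ℝ) (0 : EuclideanSpace ℝ (Fin 3)) v) s y =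
      ((2 * (lam j / 2)) / 1) • u (1 + (2 * (lam j / 2)) ^ 2 * s / 1) (0 + (2 * (lam j / 2)) • y) := by
    intro j s y
    rw [smul_stPull_apply]
    simp only [hudef, zero_add]
    congr 1
    · ring
    · congr 1
      · ring
      · congr 1; ring
  have key := curl_tendsto_of_frame_cont one_pos one_pos hucont one_pos hM (by norm_num : (0:ℝ) < 2) hball1 hlam hlam0
    hr₁ hr₁1 hKs hpt hL3 hae hP s hs y
  refine key.congr fun j => ?_
  simp only [hudef]
  congr 1
  · ring
  · congr 2
    · ring
    · simp only [zero_add]; congr 1; ring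

/-- **The sign passes to the zoom limit.**  If every vorticity slice of the profile satisfies `⟪curl v(s) y, e⟫ ≥ 0` and the zoomed
vorticities converge pointwise to `curl v₁(s)(y)`, then `⟪curl v₁(s) y, e⟫ ≥ 0`. [folklore] -/
theorem inner_curl_nonneg_of_profileZoom {v v₁ : ℝ → EuclideanSpace ℝ (Fin 3) → EuclideanSpace ℝ (Fin 3)} {lam : ℕ → ℝ}
    {e : EuclideanSpace ℝ (Fin 3)} (hsign : ∀ s < 0, ∀ y, 0 ≤ ⟪curl (v s) y, e⟫_ℝ)
    (hzoom : ∀ s < 0, ∀ y, Tendsto (fun j => (lam j) ^ 2 • curl (v ((lam j) ^ 2 * s)) ((lam j) • y)) atTop (𝓝 (curl (v₁ s) y)))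
    (hlam : ∀ j, 0 < lam j) (s : ℝ) (hs : s < 0) (y : EuclideanSpace ℝ (Fin 3)) : 0 ≤ ⟪curl (v₁ s) y, e⟫_ℝ := by
  have h := (hzoom s hs y).inner (𝕜 := ℝ) (tendsto_const_nhds (x := e))
  refine ge_of_tendsto h (Eventually.of_forall fun j => ?_)
  have hsj : (lam j) ^ 2 * s < 0 := mul_neg_of_pos_of_neg (pow_pos (hlam j) 2) hs
  show 0 ≤ ⟪(lam j) ^ 2 • curl (v ((lam j) ^ 2 * s)) ((lam j) • y), e⟫_ℝ
  rw [real_inner_smul_left]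
  exact mul_nonneg (pow_nonneg (hlam j).le 2) (hsign _ hsj _)

end Summit.NavierStokesRegularity.NavierStokesRegularity.Theorems.AveragedConeLiouvilleProfileZoom

end
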